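import Literature.NumberTheory.EllipticCurves.DeligneSerreWeightOneOfThm67
import Literature.NumberTheory.GaloisRepresentations.StableLatticeValuationRing
import Literature.NumberTheory.GaloisRepresentations.ArtinRepFrobeniusProofs
import Mathlib.RingTheory.Valuation.LocalSubring
import HarnessLib

/-!
# Deligne–Serre 1974, Thm. 6.7 in weight one, from Thm. 4.1 (reduction of the Artin representation)

A proofs-only companion (theorems only: no definitions, no named facts; D-0026) of
`Literature/NumberTheory/EllipticCurves/NewformGaloisRepModL.lean`, written by the seat of its
named fact `Literature.NumberTheory.EllipticCurves.ModularForms.DeligneSerre1974.thm67_weightOne`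
(Deligne–Serre 1974, Thm. 6.7 for a weight-one newform `f ∈ S_1(Γ₁(N))` and `ι : 𝓞_f → 𝔽_ℓ`).

The printed proof of Thm. 6.7 (op. cit. 6.8–6.13) is proved in the tree
(`NewformGaloisRepModLProofs`, `DeligneSerreWeightOneOfThm67.thm67_weightOne_of_deligneThm61`)
modulo its one external input, Deligne's Thm. 6.1 at **every** finite place, which the tree does
not carry. This file proves the **converse reduction**: Thm. 6.7 in weight one follows from the
tree's named fact `Literature.NumberTheory.EllipticCurves.ModularForms.exists_complexGaloisRep_of_weight_one`
(Deligne–Serre 1974, Thm. 4.1: the complex representation `ρ_f : Gal(ℚ̄/ℚ) → GL₂(ℂ)` with finite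
image attached to `f` away from `N`), by reducing `ρ_f` modulo a prime above `λ = ker ι` (the
relation "la réduction de `ρ` mod `λ_l` est `ρ̃_l`" of op. cit. 8.6, read backwards: there it
serves to identify `det(1 - F_p T)`; here it produces `ρ̃_λ` from `ρ`). Since a representation
with finite image is a *global* object, every `λ` is available, in contrast with the `λ`-adic
representations of weight `≥ 2` (one place per newform in the tree's
`exists_padicGaloisRep_of_isNewform1`). Consequently the two named facts `thm67_weightOne` and
`exists_complexGaloisRep_of_weight_one` are equivalent over the tree (the other direction is
`exists_complexGaloisRep_of_weight_one_of_deligneThm61` with `thm67_weightOne_of_deligneThm61`).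

Proof. Let `ρ` be given by Thm. 4.1 and `𝔭 = ker ι ⊂ 𝓞_f`. By Chevalley's extension theorem
(Mathlib `Ideal.image_subset_nonunits_valuationSubring`) there is a valuation subring `O ⊂ ℂ`
containing `𝓞_f` whose maximal ideal contains `𝔭`, so that `𝓞_f → O → κ(O)` factors through `ι`
and an embedding `j : 𝔽_ℓ → κ(O)`. The image of `ρ` is finite, so its fibres are open
(`isOpen_fiber_of_finite_range`, `ArtinRepFrobeniusProofs`) and `ρ` is continuous for the
*discrete* topology of `ℂ`, for which `O` is open: the tree's
`exists_integralModel_of_valuationSubring` (Serre's stable lattice over an arbitrary valuation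
ring, `StableLatticeValuationRing`) conjugates `ρ` into `ρ₀ : Gal(ℚ̄/ℚ) → GL₂(O)`. Reduce modulo
`𝔪_O`: `φ : Gal(ℚ̄/ℚ) → GL₂(κ(O))` has `ker ρ ≤ ker φ` (open) and, at an arithmetic Frobenius
`σ` over `p ∤ N ℓ`, `det(X - φ(σ)) = j(X² - ι(a_p) X + ι(ε(p)))`. By Chebotarev
(`exists_isArithFrobAt_apply_eq`, from the tree's `dirichletDensity_eq_holds`) every element of
the finite image is such a Frobenius ((6.12.1)), so all characteristic polynomials of `φ` lie in
`j(𝔽_ℓ[X])` and Lemme 6.13 in the tree's form `exists_descent_fin_two` (valid over any field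
`κ(O) ⊇ 𝔽_ℓ`) descends `φ` to `GL₂(𝔽_ℓ)`; a last semisimplification
(`exists_semisimplification_fin_two`) gives the representation of Thm. 6.7.

* `Literature.NumberTheory.EllipticCurves.ModularForms.DeligneSerre1974.exists_integralModel_of_isOpen_fiber`
  — integral models over ANY valuation subring for homomorphisms with open fibres (finite image)
  on a compact group (discrete-topology instance of `exists_integralModel_of_valuationSubring`);
* `Literature.NumberTheory.EllipticCurves.ModularForms.DeligneSerre1974.thm67_weightOne_of_residualModel`
  — the packaging step 6.12–6.13 for a model over any field `K ⊇ 𝔽_ℓ` with open kernel;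
* `Literature.NumberTheory.EllipticCurves.ModularForms.DeligneSerre1974.thm67_weightOne_of_complexGaloisRep`
  — Thm. 6.7 (weight one) from Thm. 4.1, Chebotarev and (2.7.2) as hypotheses;
* `Literature.NumberTheory.EllipticCurves.ModularForms.DeligneSerre1974.thm67_weightOne_of_exists_complexGaloisRep_of_weight_one`
  — the one-hypothesis form, Chebotarev and (2.7.2) discharged by the tree;
* `Literature.NumberTheory.EllipticCurves.ModularForms.DeligneSerre1974.thm67_weightOne_of_thm41_exists`,
  `…thm67_weightOne_iff_exists_complexGaloisRep_of_weight_one`, `…thm67_weightOne_iff_thm41_exists`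
  — Thm. 6.7 (weight one) from / iff Thm. 4.1 in the tree's two forms.

## References

* P. Deligne, J.-P. Serre, *Formes modulaires de poids 1*, Ann. Sci. ÉNS (4) 7 (1974), Thm. 4.1
  (p. 513), Thm. 6.7 and 6.12–6.13 (pp. 521–523), 8.6 (p. 526). [DeligneSerreASENS1974]
* J.-P. Serre, *Abelian ℓ-adic representations and elliptic curves* (1968), Ch. I §1.1, Remark 1
  (stable lattices). [SerreAbelianLadic1968]
-/

noncomputable section

open scoped MatrixGroups ModularForm NumberField Polynomial Pointwise

open CongruenceSubgroup UpperHalfPlane IsLocalRing IsDedekindDomain Polynomial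
  Rat.HeightOneSpectrum Field

namespace Literature.NumberTheory.EllipticCurves.ModularForms.DeligneSerre1974

universe u

/-! ### Finite image: integral models over any valuation ring -/

section FiniteImage

/-- **Integral models over any valuation subring, for homomorphisms with open fibres** (Serre,
*Abelian ℓ-adic representations*, I.1.1, Remark 1, in the tree's form
`exists_integralModel_of_valuationSubring`). Let `O ⊆ F` be a valuation subring of a field, `G` a
compact topological group and `ρ : G → GL_n(F)` a homomorphism with open fibres (e.g. continuous
with finite image for some Hausdorff topology on `F`). Then `ρ` is conjugate into `GL_n(O)`:
there are `P ∈ GL_n(F)` and `ρ₀ : G → GL_n(O)` with `ρ₀(g) = P⁻¹ ρ(g) P`. (Give `F` the discrete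
topology: `O` is open and `ρ` is continuous.) [cite: SerreAbelianLadic1968, Ch. I §1.1, Remark 1] -/
theorem exists_integralModel_of_isOpen_fiber {F : Type u} [Field F] (O : ValuationSubring F)
    {n : ℕ} {G : Type*} [Group G] [TopologicalSpace G] [IsTopologicalGroup G] [CompactSpace G]
    (ρ : G →* GL (Fin n) F) (hρ : ∀ x, IsOpen (ρ ⁻¹' {x})) :
    ∃ (P : GL (Fin n) F) (ρ₀ : G →* GL (Fin n) O),
      ∀ g, Matrix.GeneralLinearGroup.map O.subtype (ρ₀ g) = P⁻¹ * ρ g * P := by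
  letI : TopologicalSpace F := ⊥
  haveI : DiscreteTopology F := ⟨rfl⟩
  have hc : Continuous ρ := continuous_discrete_rng.mpr hρ
  exact GaloisRepresentations.exists_integralModel_of_valuationSubring (O := O)
    (isOpen_discrete _) ⟨ρ, hc⟩

end FiniteImage

/-! ### 6.12–6.13 for a residual model over any field containing `𝔽_ℓ` -/

section Main

variable {N : ℕ} [NeZero N]

set_option maxHeartbeats 800000 in
/-- **Deligne–Serre 1974, 6.12 (end) – 6.13, packaging.** Fix a weight-one cusp form `f` on `Γ₁(N)`,
a prime `ℓ` and `ι : 𝓞_f → 𝔽_ℓ`, and suppose given a field `K` with `j : 𝔽_ℓ → K` and a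
homomorphism `φ : Gal(ℚ̄/ℚ) → GL₂(K)` with open kernel such that, for every prime `p ∤ N ℓ`,
the inertia groups at `p` lie in `ker φ` and every arithmetic Frobenius `σ` at `p` has
`det(X - φ(σ)) = j(ι(X² - a_p X + ε(p)))`. Then the conclusion of Thm. 6.7 holds for `(f, ℓ, ι)`:
by Chebotarev every element of the (finite) image is a Frobenius at some `p ∤ N ℓ` ((6.12.1)), so
all characteristic polynomials of `φ` lie in `j(𝔽_ℓ[X])`; Lemme 6.13 (the tree's
`exists_descent_fin_two`, over an arbitrary `K`) descends `φ` to `GL₂(𝔽_ℓ)`, and a last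
semisimplification gives a semisimple `ρ̄ : Gal(ℚ̄/ℚ) → GL₂(𝔽_ℓ)` attached to `f` through `ι`
away from `N ℓ`. [cite: DeligneSerreASENS1974, 6.12 (6.12.1) and Lemme 6.13 (pp. 522–523)] -/
theorem thm67_weightOne_of_residualModel
    (hCheb : LFunctions.Chebotarev.dirichletDensity_eq.{0})
    {f : CuspForm (Gamma1 N) 1} (ℓ : ℕ) [Fact ℓ.Prime]
    (ι : coeffCharIntegers f →+* ZMod ℓ)
    {K : Type} [Field K] (j : ZMod ℓ →+* K) (φ : absoluteGaloisGroup ℚ →* GL (Fin 2) K)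
    (hker : IsOpen (φ.ker : Set (absoluteGaloisGroup ℚ)))
    (hunr : ∀ w : HeightOneSpectrum (𝓞 ℚ), ¬ ((primesEquiv w : Nat.Primes) : ℕ) ∣ N * ℓ →
      ∀ 𝔓 ∈ w.primesAbove, ∀ σ ∈ 𝔓.inertia (absoluteGaloisGroup ℚ), φ σ = 1)
    (hfrob : ∀ w : HeightOneSpectrum (𝓞 ℚ), ¬ ((primesEquiv w : Nat.Primes) : ℕ) ∣ N * ℓ →
      ∃ P : Polynomial (coeffCharIntegers f),
        P.map (algebraMap (coeffCharIntegers f) (coeffCharField f)) =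
            heckePolynomial f ((primesEquiv w : Nat.Primes) : ℕ) ∧
          ∀ 𝔓 ∈ w.primesAbove, ∀ σ : absoluteGaloisGroup ℚ, IsArithFrobAt (𝓞 ℚ) σ 𝔓 →
            ((φ σ : GL (Fin 2) K) : Matrix (Fin 2) (Fin 2) K).charpoly = (P.map ι).map j) :
    ∃ ρbar : GaloisRepresentations.FramedGaloisRep ℚ (ZMod ℓ) 2,
      IsGaloisRepOfNewform1Int f ι {p | p ∣ N * ℓ} ρbar ∧ ρbar.toGaloisRep.IsSemisimple := by
  classical
  have hℓ : ℓ.Prime := Fact.out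
  -- ### (6.12.1): all characteristic polynomials of `φ` come from `𝔽_ℓ`
  have hT : ({p : ℕ | p ∣ N * ℓ}).Finite :=
    (Set.finite_Iic (N * ℓ)).subset fun q hq ↦ Nat.le_of_dvd
      (Nat.pos_of_ne_zero (mul_ne_zero (NeZero.ne N) hℓ.ne_zero)) hq
  have hQ : ∀ x : absoluteGaloisGroup ℚ, ∃ Q : Polynomial (ZMod ℓ),
      Q.map j = ((φ x : GL (Fin 2) K) : Matrix (Fin 2) (Fin 2) K).charpoly := by
    intro x
    obtain ⟨w, hw, 𝔓, h𝔓, σ, hσ, hσx⟩ := exists_isArithFrobAt_apply_eq hCheb φ hker _ hT x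
    obtain ⟨P, -, hP⟩ := hfrob w hw
    exact ⟨P.map ι, by rw [← hσx, hP 𝔓 h𝔓 σ hσ]⟩
  -- ### Lemme 6.13 over `𝔽_ℓ ⊆ K`, and a last semisimplification over `𝔽_ℓ`
  obtain ⟨ρ₁, hρ₁ker, hρ₁char⟩ :=
    Literature.RepresentationTheory.Semisimple.exists_descent_fin_two j φ hQ
  obtain ⟨ρ₂, hρ₂ss, hρ₂char, hρ₂ker⟩ :=
    Literature.RepresentationTheory.Semisimple.exists_semisimplification_fin_two ρ₁
  have hker₂ : φ.ker ≤ ρ₂.ker := fun x hx ↦ hρ₂ker (hρ₁ker hx)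
  -- ### the mod-`ℓ` representation
  let ρbar : GaloisRepresentations.FramedGaloisRep ℚ (ZMod ℓ) 2 :=
    ⟨ρ₂, continuous_of_isOpen_of_le_ker ρ₂ φ.ker hker hker₂⟩
  have hρbar : ∀ σ, ρbar σ = ρ₂ σ := fun _ ↦ rfl
  refine ⟨ρbar, fun w hw ↦ ?_, hρ₂ss⟩
  obtain ⟨P, hP, hPσ⟩ := hfrob w hw
  refine ⟨?_, P, hP, ?_⟩
  · -- unramified
    intro 𝔓 h𝔓 σ hσ
    rw [hρbar]
    exact hker₂ (hunr w hw 𝔓 h𝔓 σ hσ)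
  · -- Frobenius characteristic polynomials
    intro 𝔓 h𝔓 σ hσ
    change ((ρ₂ σ : GL (Fin 2) (ZMod ℓ)) : Matrix (Fin 2) (Fin 2) (ZMod ℓ)).charpoly = _
    apply Polynomial.map_injective j j.injective
    rw [hρ₂char, hρ₁char, hPσ 𝔓 h𝔓 σ hσ]

set_option maxHeartbeats 1600000 in
/-- **Deligne–Serre 1974, Thm. 6.7 (weight one, `k_λ = 𝔽_ℓ`) from Thm. 4.1.** Hypotheses:
`h41` = Thm. 4.1 in the tree's form `exists_complexGaloisRep_of_weight_one` (for every weight-one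
newform `f` on `Γ₁(N)`, a continuous `ρ : Gal(ℚ̄/ℚ) → GL₂(ℂ)` with finite image attached to `f`
away from `N`); `hCheb` = Chebotarev's density theorem over `ℚ`; `hL` = (2.7.2) in weight one
(integrality of the `a_p`). Conclusion: the named fact `thm67_weightOne`. Proof (the reduction
of `ρ_f` modulo `λ`, cf. op. cit. 8.6 "la réduction de `ρ` mod `λ_l` est `ρ̃_l`"): a valuation
subring `O ⊂ ℂ` dominating `(𝓞_f)_𝔭`, `𝔭 = ker ι` (Chevalley,
`Ideal.image_subset_nonunits_valuationSubring`); an integral model `ρ₀ : Gal(ℚ̄/ℚ) → GL₂(O)`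
(`exists_integralModel_of_isOpen_fiber`, finite image); reduction modulo `𝔪_O`, whose Frobenius
characteristic polynomials at `p ∤ N ℓ` are `j(ι(X² - a_p X + ε(p)))`; and
`thm67_weightOne_of_residualModel` (Chebotarev, Lemme 6.13, semisimplification).
[cite: DeligneSerreASENS1974, Thm. 6.7 and Thm. 4.1 (with 6.12–6.13 and 8.6)] -/
theorem thm67_weightOne_of_complexGaloisRep
    (hCheb : LFunctions.Chebotarev.dirichletDensity_eq.{0})
    (hL : DeligneSerre1974_span_integralLattice1 N 1)
    (h41 : exists_complexGaloisRep_of_weight_one (N := N)) :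
    thm67_weightOne (N := N) := by
  intro f hf ℓ _ ι
  classical
  have hℓ : ℓ.Prime := Fact.out
  obtain ⟨ρ, hρf, -, hfin, -⟩ := h41 hf
  -- ### the coefficient ring `𝓞_f ⊂ ℂ` and a valuation ring of `ℂ` above `ker ι` (Chevalley)
  set e : coeffCharIntegers f →+* ℂ :=
    (algebraMap (coeffCharField f) ℂ).comp (algebraMap (coeffCharIntegers f) (coeffCharField f))
    with he
  have heinj : Function.Injective e := by
    intro x y h
    apply Subtype.ext
    apply Subtype.ext
    exact h
  set eR : coeffCharIntegers f →+* e.range := e.rangeRestrict with heR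
  have heRsurj : Function.Surjective eR := RingHom.rangeRestrict_surjective e
  have heRinj : Function.Injective eR := fun x y hxy ↦ heinj (by
    have := congrArg (fun z : e.range ↦ (z : ℂ)) hxy
    simpa [heR] using this)
  set I : Ideal e.range := (RingHom.ker ι).map eR with hIdef
  have hI : I ≠ ⊤ := by
    intro htop
    have h1 : (1 : e.range) ∈ I := htop ▸ Submodule.mem_top
    rw [hIdef, Ideal.mem_map_iff_of_surjective eR heRsurj] at h1
    obtain ⟨x, hx, hx1⟩ := h1
    have hx1' : x = 1 := heRinj (by rw [hx1, map_one])
    rw [hx1', RingHom.mem_ker, map_one] at hx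
    exact one_ne_zero hx
  obtain ⟨O, hAO, hIO⟩ := Ideal.image_subset_nonunits_valuationSubring I hI
  -- `𝓞_f → O`
  let toO : coeffCharIntegers f →+* O := (Subring.inclusion hAO).comp eR
  have htoO : ∀ y, ((toO y : O) : ℂ) = e y := fun _ ↦ rfl
  have htoO_comp : O.subtype.comp toO = e := RingHom.ext htoO
  -- the residue map `𝓞_f → κ(O)` factors through `ι`
  let ψ : coeffCharIntegers f →+* ResidueField O := (residue O).comp toO
  have hkerle : RingHom.ker ι ≤ RingHom.ker ψ := by
    intro y hy
    have hyI : eR y ∈ I := Ideal.mem_map_of_mem _ hy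
    have hynon : e y ∈ O.nonunits := hIO ⟨eR y, hyI, rfl⟩
    rw [RingHom.mem_ker]
    change residue O (toO y) = 0
    rw [residue_eq_zero_iff, ← ValuationSubring.coe_mem_nonunits_iff, htoO]
    exact hynon
  have hιsurj : Function.Surjective ι := ZMod.ringHom_surjective ι
  let j : ZMod ℓ →+* ResidueField O :=
    (ι.liftOfRightInverse (Function.surjInv hιsurj) (Function.rightInverse_surjInv hιsurj))
      ⟨ψ, hkerle⟩
  have hj : ∀ y : coeffCharIntegers f, j (ι y) = ψ y := fun y ↦
    RingHom.liftOfRightInverse_comp_apply ι _ _ ⟨ψ, hkerle⟩ y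
  have hjcomp : j.comp ι = ψ := RingHom.ext hj
  -- ### integral model over `O` (finite image) and its reduction
  have hfib : ∀ x, IsOpen (ρ.toMonoidHom ⁻¹' {x}) := fun x ↦
    GaloisRepresentations.DeligneSerre1974.isOpen_fiber_of_finite_range ρ.continuous_toFun hfin x
  obtain ⟨Pc, ρ₀, hρ₀⟩ := exists_integralModel_of_isOpen_fiber O ρ.toMonoidHom hfib
  set φ : absoluteGaloisGroup ℚ →* GL (Fin 2) (ResidueField O) :=
    (Matrix.GeneralLinearGroup.map (residue O)).comp ρ₀ with hφ
  have hsubinj : Function.Injective (Matrix.GeneralLinearGroup.map (n := Fin 2) O.subtype) :=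
    generalLinearGroup_map_injective_of_injective O.subtype Subtype.val_injective
  -- kernels: `ρ σ = 1 → φ σ = 1`
  have hchain : ∀ σ, ρ σ = 1 → φ σ = 1 := by
    intro σ hσ
    have h1 : ρ₀ σ = 1 := hsubinj (by
      rw [hρ₀, map_one]
      change Pc⁻¹ * ρ σ * Pc = 1
      rw [hσ, mul_one, inv_mul_cancel])
    rw [hφ, MonoidHom.comp_apply, h1, map_one]
  have hρker : IsOpen ((ρ.toMonoidHom.ker : Subgroup (absoluteGaloisGroup ℚ)) :
      Set (absoluteGaloisGroup ℚ)) := by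
    rw [MonoidHom.coe_ker]
    exact hfib 1
  have hφker : IsOpen (φ.ker : Set (absoluteGaloisGroup ℚ)) :=
    Subgroup.isOpen_mono (H₁ := ρ.toMonoidHom.ker) (fun σ hσ ↦ hchain σ hσ) hρker
  -- ### the integral Hecke polynomials
  set ε : DirichletCharacter ℂ N := nebentypus f with hεdef
  have hint : ∀ n, IsIntegral ℤ (cuspCoeff f n) := fun n ↦
    IsNewform1.isIntegral_cuspCoeff hL le_rfl hf n
  let aInt : ℕ → coeffCharIntegers f := fun p ↦
    ⟨⟨cuspCoeff f p, cuspCoeff_mem_coeffCharField f p⟩, (isIntegral_coeffCharField_iff f).mpr (hint p)⟩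
  let cInt : ℕ → coeffCharIntegers f := fun p ↦
    ⟨⟨(ε (p : ZMod N) : ℂ) * (p : ℂ) ^ ((1 : ℤ) - 1), nebentypus_mul_zpow_mem_coeffCharField f p⟩,
      (isIntegral_coeffCharField_iff f).mpr (isIntegral_nebentypus_mul_zpow f le_rfl p)⟩
  let Pint : ℕ → Polynomial (coeffCharIntegers f) := fun p ↦ X ^ 2 - C (aInt p) * X + C (cInt p)
  have hPint : ∀ p : ℕ, (Pint p).map (algebraMap (coeffCharIntegers f) (coeffCharField f)) =
      heckePolynomial f p := by
    intro p
    simp only [Pint, heckePolynomial, Polynomial.map_add, Polynomial.map_sub,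
      Polynomial.map_mul, Polynomial.map_pow, Polynomial.map_X, Polynomial.map_C]
    rfl
  -- ### Frobenius characteristic polynomials of `φ` at the good primes
  refine thm67_weightOne_of_residualModel hCheb ℓ ι j φ hφker
    (fun w hw 𝔓 h𝔓 σ hσ ↦ ?_) (fun w hw ↦ ⟨Pint _, hPint _, fun 𝔓 h𝔓 σ hσ ↦ ?_⟩)
  · -- unramified at `p ∤ N ℓ`
    have hpN : ((primesEquiv w : Nat.Primes) : ℕ) ∉ {p : ℕ | p ∣ N} := fun h ↦ hw (h.mul_right ℓ)
    exact hchain σ ((hρf w hpN).1 𝔓 h𝔓 σ hσ)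
  · set p : ℕ := ((primesEquiv w : Nat.Primes) : ℕ) with hpdef
    have hpN : p ∉ {p : ℕ | p ∣ N} := fun h ↦ hw (h.mul_right ℓ)
    have hcσ : ((ρ σ : GL (Fin 2) ℂ) : Matrix (Fin 2) (Fin 2) ℂ).charpoly = (Pint p).map e := by
      have h := (hρf w hpN).2 𝔓 h𝔓 σ hσ
      change ((ρ σ : GL (Fin 2) ℂ) : Matrix (Fin 2) (Fin 2) ℂ).charpoly = _ at h
      rw [h, ← hPint, Polynomial.map_map]
    -- `charpoly (ρ₀ σ) = Pint p` over `O`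
    have h0 : ((ρ₀ σ : GL (Fin 2) O) : Matrix (Fin 2) (Fin 2) O).charpoly = (Pint p).map toO := by
      apply Polynomial.map_injective O.subtype Subtype.val_injective
      rw [GaloisRepresentations.charpoly_integralModel hρ₀ σ, Polynomial.map_map, htoO_comp]
      exact hcσ
    rw [hφ, GaloisRepresentations.charpoly_residualRep ρ₀ σ, h0, Polynomial.map_map,
      Polynomial.map_map, hjcomp]

/-- **Deligne–Serre 1974, Thm. 6.7 in weight one from Thm. 4.1 alone.** The named fact
`thm67_weightOne` (for a newform `f ∈ S_1(Γ₁(N))`, a prime `ℓ` and `ι : 𝓞_f → 𝔽_ℓ`, a semisimple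
`ρ̄ : Gal(ℚ̄/ℚ) → GL₂(𝔽_ℓ)` unramified outside `N ℓ` with `det(X - ρ̄(F_p)) = X² - ι(a_p) X + ι(ε(p))`
for `p ∤ N ℓ`) follows from the named fact `exists_complexGaloisRep_of_weight_one` (Thm. 4.1), by
`thm67_weightOne_of_complexGaloisRep` with Chebotarev (`dirichletDensity_eq_holds`) and (2.7.2)
(`DeligneSerre1974_span_integralLattice1_holds`) discharged by the tree. Hence
`thm67_weightOne_holds` is `thm67_weightOne_of_exists_complexGaloisRep_of_weight_one h` for any
proof `h` of Thm. 4.1. [cite: DeligneSerreASENS1974, Thm. 6.7 and Thm. 4.1 (with 8.6)] -/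
theorem thm67_weightOne_of_exists_complexGaloisRep_of_weight_one
    (h41 : exists_complexGaloisRep_of_weight_one (N := N)) : thm67_weightOne (N := N) :=
  thm67_weightOne_of_complexGaloisRep LFunctions.Chebotarev.dirichletDensity_eq_holds
    (DeligneSerre1974_span_integralLattice1_holds N 1) h41

/-- **Thm. 6.7 in weight one from Thm. 4.1 (existence part only).** The named fact
`thm67_weightOne` follows already from `thm41_exists` (`NewformGaloisRepProofs`: a continuous
`ρ : Gal(ℚ̄/ℚ) → GL₂(ℂ)` with finite image attached to `f` away from `N`, without irreducibility
or oddness), through the tree's `exists_complexGaloisRep_of_weight_one_of_thm41_exists`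
(irreducibility §8.7 and oddness Rem. 4.5, proved in `DeligneSerreWeightOneIrreducibleHolds`) and
`thm67_weightOne_of_exists_complexGaloisRep_of_weight_one`.
[cite: DeligneSerreASENS1974, Thm. 6.7 and Thm. 4.1 (with 8.6)] -/
theorem thm67_weightOne_of_thm41_exists (h41 : thm41_exists (N := N)) : thm67_weightOne (N := N) :=
  thm67_weightOne_of_exists_complexGaloisRep_of_weight_one
    (exists_complexGaloisRep_of_weight_one_of_thm41_exists h41)

/-- **The weight-one facts of Deligne–Serre 1974 are equivalent over the tree**: Thm. 6.7 in
weight one (`thm67_weightOne`, the mod-`ℓ` representations for every `ι : 𝓞_f → 𝔽_ℓ`) holds iff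
Thm. 4.1 does (`exists_complexGaloisRep_of_weight_one`, the complex representation with finite
image, irreducible and odd): `→` is the printed proof §8 (`exists_complexGaloisRep_of_weight_one_of_thm67`,
`DeligneSerreWeightOneOfThm67`), `←` is the reduction of `ρ_f` modulo `λ`
(`thm67_weightOne_of_exists_complexGaloisRep_of_weight_one`). Both are proved in the tree modulo
Deligne's Thm. 6.1 at every finite place (`thm67_weightOne_of_deligneThm61`,
`exists_complexGaloisRep_of_weight_one_of_deligneThm61`).
[cite: DeligneSerreASENS1974, Thm. 4.1 and Thm. 6.7 (§8, 8.6)] -/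
theorem thm67_weightOne_iff_exists_complexGaloisRep_of_weight_one :
    thm67_weightOne (N := N) ↔ exists_complexGaloisRep_of_weight_one (N := N) :=
  ⟨exists_complexGaloisRep_of_weight_one_of_thm67,
    thm67_weightOne_of_exists_complexGaloisRep_of_weight_one⟩

/-- **Thm. 6.7 (weight one) iff Thm. 4.1 (existence with §3 (a))**: `thm67_weightOne ↔ thm41_exists`
over the tree (`thm41_exists_of_thm67`, `DeligneSerreWeightOneOfThm67`, and
`thm67_weightOne_of_thm41_exists`). [cite: DeligneSerreASENS1974, Thm. 4.1 and Thm. 6.7 (§8, 8.6)] -/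
theorem thm67_weightOne_iff_thm41_exists : thm67_weightOne (N := N) ↔ thm41_exists (N := N) :=
  ⟨thm41_exists_of_thm67, thm67_weightOne_of_thm41_exists⟩

end Main

end Literature.NumberTheory.EllipticCurves.ModularForms.DeligneSerre1974

end
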